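import Summits.Ventures.QEC.CircuitDistance.SchedTableCheck
import Summits.Ventures.QEC.CircuitDistance.SchedKindColumns
import Summits.Ventures.QEC.CircuitDistance.SchedColumns
import HarnessLib

/-!
# Q4 lane, ₛ-spine (8X): the `X`-sector TABLE machinery for any CNOT order — representatives from the table, the FAST COLUMN,
# the `X`-sector DEM and its class hypothesis (venture QEC, experiment cell CDX, seat qec-cdx-type-2; the `PortXTable.lean`
# layer of record re-pointed from `shape`/`run1` to `shapeₛ σ S`/`Gen.run1 S (allEventsₛ σ Nc)` under `hσ : σ.CycleFacts S`;
# nothing here asserts a value of `d_circ`)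

Reused UNCHANGED from the files of record (order-free): the table format `XTable`, `indic`, `trQ`, `XTable.classRow/ClassCorrect`,
the column FORMULA `XTable.colFormula` and the fast column `XTable.detFast` (pure table arithmetic), `encDet`, `XNontrivial`, `scope`,
`HX_row_mem_rowSpace`, `indic_trQ`, `HX_row_translate`. Re-pointed (proofs verbatim): `XTable.mZ_of_tableₛ`, `mZ_of_table_neₛ`,
`dataXb_of_tableₛ` (from `shapeRowₛ`, via `shapeₛ_translate`/`shapeₛ_retag`), `xDetₛ`, `XTable.colFormula_eqₛ`,
**`XTable.detFast_eq_xDetₛ`** (the fast column IS the column of the representative in the schedule's circuit), `xDEMₛ` and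
**`classHyp_xDEMₛ`** (a shape-correct (for `σ`) and class-correct table gives the class hypothesis of the `X`-sector DEM of the
`Nc`-cycle circuit run with `σ`).
-/

namespace Summit.Ventures.QEC.CircuitDistance

open Literature.InformationTheory.QuantumCodes

variable {ℓ m : ℕ} [NeZero ℓ] [NeZero m]

/-! ## Representatives from the table -/

/-- Shapes of arbitrary representatives from the table: in-cycle `Z`-flips (cf. `XTable.mZ_of_table`). -/
theorem XTable.mZ_of_tableₛ {σ : SMSchedule} {S : SMCode ℓ m} {T : XTable ℓ m} {k : XKind} (h : T.shapeRowₛ σ S k = true) (c : ℕ)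
    (i j : BB.Mono ℓ m) : (shapeₛ σ S (k.fault c i)).mZ c j = decide (j - i ∈ T.muZ k) := by
  rw [XKind.fault_eq_translate, shapeₛ_translate, XKind.fault_eq_retag, shapeₛ_retag]
  simp only [State.translate, XKind.cyc_fault, if_true]
  exact (XTable.shapeRowₛ_spec h).1 (j - i)

/-- `Z`-flips outside the own cycle vanish (cf. `XTable.mZ_of_table_ne`). -/
theorem XTable.mZ_of_table_neₛ (σ : SMSchedule) (S : SMCode ℓ m) {k : XKind} {c t : ℕ} (ht : t ≠ c) (i j : BB.Mono ℓ m) :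
    (shapeₛ σ S (k.fault c i)).mZ t j = false :=
  shapeₛ_mZ_of_ne σ S _ (by rw [XKind.cyc_fault]; exact ht) j

/-- Residual support of arbitrary representatives from the table (cf. `XTable.dataXb_of_table`). -/
theorem XTable.dataXb_of_tableₛ {σ : SMSchedule} {S : SMCode ℓ m} {T : XTable ℓ m} {k : XKind} (h : T.shapeRowₛ σ S k = true)
    (c : ℕ) (i : BB.Mono ℓ m) (q : BB.Mono ℓ m ⊕ BB.Mono ℓ m) :
    (shapeₛ σ S (k.fault c i)).frame.dataXb q = decide (q ∈ trQ i (T.ex k)) := by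
  rw [XKind.fault_eq_translate, shapeₛ_translate, dataXb_translate, XKind.fault_eq_retag, shapeₛ_retag]
  exact ((XTable.shapeRowₛ_spec h).2 _).trans (decide_eq_decide.mpr (mem_trQ i _ q).symm)

/-! ## The column and the fast column -/

/-- The true `X`-column detector set of a fault in the `Nc`-cycle circuit of `σ`: `{(t − 1, j) : detZ t j}` (cf. `xDet`). -/
def xDetₛ (σ : SMSchedule) (S : SMCode ℓ m) (Nc : ℕ) (f : Fault ℓ m) : Finset (ℕ × BB.Mono ℓ m) :=
  ((Finset.range (Nc + 2)) ×ˢ (Finset.univ : Finset (BB.Mono ℓ m))).filter fun p =>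
    Gen.detZ S Nc (allEventsₛ σ Nc) {f} (p.1 + 1) p.2

/-- ANCHOR: under print's order `xDetₛ` is the landed `xDet`. -/
theorem xDetₛ_sched204 (S : SMCode ℓ m) (Nc : ℕ) (f : Fault ℓ m) : xDetₛ sched204 S Nc f = xDet S Nc f := by
  unfold xDetₛ xDet; rw [allEventsₛ_sched204]; rfl

/-- The (order-free) column FORMULA is the column of the representative in `σ`'s circuit (cf. `XTable.colFormula_eq`). -/
theorem XTable.colFormula_eqₛ {σ : SMSchedule} {S : SMCode ℓ m} (hσ : σ.CycleFacts S) {T : XTable ℓ m} {k : XKind}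
    (h : T.shapeRowₛ σ S k = true) (Nc : ℕ) (i : BB.Mono ℓ m) (c : ℕ) (h₁ : 1 ≤ c) (h₂ : c ≤ Nc) (s : ℕ) (j : BB.Mono ℓ m) :
    T.colFormula S Nc k i c s j = Gen.detZ S Nc (allEventsₛ σ Nc) {k.fault c i} (s + 1) j := by
  have hc : (k.fault c i : Fault ℓ m).cyc = c := XKind.cyc_fault k c i
  rw [detZₛ_singleton hσ Nc (k.fault c i) (by rw [hc]; exact h₁) (by rw [hc]; exact h₂), hc, XTable.mZ_of_tableₛ h c i j,
    ancZx_kindₛ]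
  have hd : (shapeₛ σ S (k.fault c i)).frame.dataXb = fun q => decide (q ∈ trQ i (T.ex k)) :=
    funext fun q => XTable.dataXb_of_tableₛ h c i q
  rw [hd]
  rfl

/-- **The fast column is the column**, in the circuit of any order with the cycle facts (cf. `XTable.detFast_eq_xDet`). -/
theorem XTable.detFast_eq_xDetₛ {σ : SMSchedule} {S : SMCode ℓ m} (hσ : σ.CycleFacts S) {T : XTable ℓ m} {k : XKind}
    (h : T.shapeRowₛ σ S k = true) (Nc : ℕ) (i : BB.Mono ℓ m) (c : ℕ) (h₁ : 1 ≤ c) (h₂ : c ≤ Nc) :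
    T.detFast S Nc k i c = xDetₛ σ S Nc (k.fault c i) := by
  ext ⟨s, j⟩
  simp only [XTable.detFast, xDetₛ, Finset.mem_filter, Finset.mem_product, Finset.mem_univ, and_true, Finset.mem_range,
    Finset.mem_insert, Finset.mem_singleton, XTable.colFormula_eqₛ hσ h Nc i c h₁ h₂]
  constructor
  · rintro ⟨hs, hd⟩
    refine ⟨?_, hd⟩
    rcases hs with rfl | rfl | rfl
    · omega
    · omega
    · have hc : (k.fault c i : Fault ℓ m).cyc = c := XKind.cyc_fault k c i
      rw [detZₛ_singleton hσ Nc (k.fault c i) (by rw [hc]; exact h₁) (by rw [hc]; exact h₂), hc] at hd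
      by_contra hN
      have e1 : ¬ (c + 1 + 1 = c) := by omega
      have e2 : ¬ (c + 1 + 1 = c + 1) := by omega
      have e3 : ¬ (c + 1 ≤ Nc) := by omega
      rw [decide_eq_false e1, decide_eq_false e2, decide_eq_false e3] at hd
      simp at hd
  · rintro ⟨hs, hd⟩
    refine ⟨?_, hd⟩
    have hc : (k.fault c i : Fault ℓ m).cyc = c := XKind.cyc_fault k c i
    rw [detZₛ_singleton hσ Nc (k.fault c i) (by rw [hc]; exact h₁) (by rw [hc]; exact h₂), hc] at hd
    by_contra hne
    push Not at hne
    have e1 : ¬ (s + 1 = c) := by omega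
    have e2 : ¬ (s + 1 = c + 1) := by omega
    have e3 : ¬ (s + 1 = c + 2) := by omega
    rw [decide_eq_false e1, decide_eq_false e2, decide_eq_false e3] at hd
    simp at hd

/-! ## The `X`-sector DEM of a scheduled circuit and its class hypothesis -/

/-- The `X`-sector DEM of the `Nc`-cycle circuit of order `σ`, classes read off the table `T` (cf. `xDEM`). -/
def xDEMₛ (σ : SMSchedule) (S : SMCode ℓ m) (T : XTable ℓ m) (Nc : ℕ) :
    Fibre.DEM (Fault ℓ m) (ℕ × BB.Mono ℓ m) (Finset (BB.Mono ℓ m ⊕ BB.Mono ℓ m)) (BB.Mono ℓ m ⊕ BB.Mono ℓ m → ZMod 2) where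
  det := xDetₛ σ S Nc
  res := fun f => Gen.dataX S (allEventsₛ σ Nc) {f}
  cls := fun f => f.xKind.bind fun ki => (T.cls ki.1).map (trQ ki.2)
  gen := indic
  stab := rowSpace S.toCode.HX

/-- **Class hypothesis of the `X`-sector DEM** of `σ`'s circuit from a shape-correct (for `σ`) and class-correct table
(cf. `classHyp_xDEM`). -/
theorem classHyp_xDEMₛ {σ : SMSchedule} {S : SMCode ℓ m} (hσ : σ.CycleFacts S) (T : XTable ℓ m) (hS : T.ShapeCorrectₛ σ S)
    (hC : T.ClassCorrect S) (Nc : ℕ) : Fibre.ClassHyp (xDEMₛ σ S T Nc) (scope Nc) := by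
  intro f hf
  obtain ⟨h₁, h₂⟩ := hf
  rcases hk : f.xKind with _ | ⟨k, i⟩
  · have h0 := (Gen.xColumn_zero_of_xKind S Nc (allEventsₛ σ Nc) f hk).2
    refine ⟨fun _ => ?_, fun g hg => ?_⟩
    · show Gen.dataX S (allEventsₛ σ Nc) {f} ∈ rowSpace S.toCode.HX; rw [h0]; exact Submodule.zero_mem _
    · simp [xDEMₛ, hk] at hg
  · have hkall : k ∈ XKind.all := XKind.mem_all k (fun lay => Fault.xKind_ne_zero hk lay)
    have hrow := hS k hkall
    have hcls := hC k hkall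
    unfold XTable.classRow at hcls
    rw [decide_eq_true_eq] at hcls
    have hres : Gen.dataX S (allEventsₛ σ Nc) {f} = indic (trQ i (T.ex k)) := by
      rw [(Gen.xColumn_eq_of_xKind S Nc (allEventsₛ σ Nc) f hk).2,
        dataXₛ_singleton hσ Nc (k.fault f.cyc i) (by rw [XKind.cyc_fault]; exact h₁) (by rw [XKind.cyc_fault]; exact h₂)]
      funext q; unfold toZ2 indic; rw [XTable.dataXb_of_tableₛ hrow]
      by_cases hq : q ∈ trQ i (T.ex k) <;> simp [hq]
    have hsum : indic (trQ i (T.ex k)) = indic (trQ i ((T.cls k).getD ∅)) + ∑ r ∈ T.cert k, fun q => S.toCode.HX (r + i) q := by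
      rw [indic_trQ, indic_trQ, hcls]
      funext q
      simp only [Pi.add_apply, Finset.sum_apply]
      congr 1
      apply Finset.sum_congr rfl
      intro r _
      exact congrFun (HX_row_translate S r i) q
    have hstab : (∑ r ∈ T.cert k, fun q => S.toCode.HX (r + i) q) ∈ rowSpace S.toCode.HX :=
      Submodule.sum_mem _ fun r _ => HX_row_mem_rowSpace S (r + i)
    refine ⟨fun hnone => ?_, fun g hg => ?_⟩
    · simp only [xDEMₛ, hk, Option.bind_some] at hnone
      rw [Option.map_eq_none_iff] at hnone
      show Gen.dataX S (allEventsₛ σ Nc) {f} ∈ rowSpace S.toCode.HX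
      rw [hres, hsum, hnone]
      simp only [Option.getD_none]
      have : indic (trQ i (∅ : Finset (BB.Mono ℓ m ⊕ BB.Mono ℓ m))) = 0 := by
        funext q; simp [indic, trQ]
      rw [this, zero_add]; exact hstab
    · simp only [xDEMₛ, hk, Option.bind_some] at hg
      obtain ⟨g₀, hg₀, rfl⟩ := Option.map_eq_some_iff.1 hg
      show Gen.dataX S (allEventsₛ σ Nc) {f} - indic (trQ i g₀) ∈ rowSpace S.toCode.HX
      rw [hres, hsum, hg₀]
      simp only [Option.getD_some, add_sub_cancel_left]
      exact hstab

end Summit.Ventures.QEC.CircuitDistance
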